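import Summits.KontsevichZagierPeriods.KontsevichZagierPeriods.Theses.HurwitzMicroSectors
import Summits.KontsevichZagierPeriods.KontsevichZagierPeriods.Theorems.HurwitzMicroSectorsNormalFormPrinciplePiBoxTransfer

/-! TTRL-lite variant V2284 of stmt-KontsevichZagierPeriods-3869

Variant V2284 = `stub_boxRigidity` (the leaf `BoxRigidity` of `NormalFormPrinciple`: two BOX-RATIONAL
representations — domain the open unit box, integrand `p/q` over `ℚ` — with equal values are
KZ-equivalent) under the two-sided move `fix_nat:m=5; bound_nat:m'≤2` (left dimension frozen to `5`,
right dimension `≤ 2`). Verdict of the attempt seat: **open** — this file is the exact-strength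
certificate, not a proof of the variant. As for every two-sided sibling (V2204, V2238, V2239, V2338,
V2340, V2349, V2350), the strength depends only on the LARGEST dimension allowed (here `5`): with
`BoxVanishing K` := "a box-rational representation of dimension `K` and value `0` is a relation",
* `V2284 ⟺ BoxVanishing 5` (`stub_boxRigidity_var2284_iff_boxVanishing_five`): (⇒) compare a
  vanishing representation on `(0,1)⁵` with the zero representation on the `0`-box (`m' = 0 ≤ 2`,
  `boxVanishing_five_of_stub_boxRigidity_var2284`); (⇐) pad both representations to the `5`-box by unit
  intervals and subtract the integrands there (`pad_le`, `sub_same`, tree; the difference has value `0`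
  by soundness: `boxRigidityLe_five_of_boxVanishing_five`);
* hence `V2284 ⟺ BoxRigidity for all m, m' ≤ 5` (`stub_boxRigidity_var2284_iff_le_five`), i.e. V2284
  coincides with EVERY sibling `fix/bound m, m'` of maximum `5`, and implies those of smaller maximum
  (`stub_boxRigidity_var2238_of_stub_boxRigidity_var2284`: ⇒ V2238 = `BoxVanishing 3`;
  `stub_boxRigidity_var2338_of_stub_boxRigidity_var2284`: ⇒ V2338 = `BoxVanishing 2`);
* `KontsevichZagierPeriods ⇒ V2284` (`stub_boxRigidity_var2284_of_statement`), so a refutation of the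
  variant would refute the Summit.
Why open: `BoxVanishing 5 ⇒ BoxVanishing 2` (`boxVanishing_le_five_of_boxVanishing_five`), and
`BoxVanishing 2` already asserts that every vanishing combination `∫_{(0,1)²} p/q = 0` (`p, q ∈ ℚ[x,y]`)
is generated by the four moves. Every side condition of a move is a sentence of the theory of real
closed fields over `ℚ`, independent of the value; so for `[(0,1)², (1 - c(1+x²y²))/(1+x²y²)]`
(value `G - c`, `G` = Catalan's constant, `c : ℚ`) a proof must either refute `G = c` or exhibit a chain
(which by soundness forces `G = c`): uniformly in `c`, an irrationality proof of `G` — open; dimension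
`5` adds `ζ(5)`, `ζ(3)π²`, `Li₅` values. `BoxVanishing ≤ 1` is the theorem `boxRigidity_of_le_one`
(Baker) of the tree; nothing in the tree or the literature decides dimension `≥ 2`.
Source: M. Kontsevich, D. Zagier, *Periods* (2001), §1.2 Conjecture 1 and rules 1)–3).
Pure proof file, no definitions. -/

-- `Summit.<Summit>.<Problem>` is the tree's mandated summit-side namespace (CONVENTIONS §2); for this
-- single-conjunct summit the two coincide, so the duplicate is deliberate.
set_option linter.dupNamespace false

noncomputable section

namespace Summit.KontsevichZagierPeriods.KontsevichZagierPeriods.Theorems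

open MeasureTheory Set
open Literature.NumberTheory.Transcendental Literature.NumberTheory.Transcendental.KZ
open Summit.KontsevichZagierPeriods.KontsevichZagierPeriods.Theses.HurwitzMicroSectors
open Summit.KontsevichZagierPeriods.HurwitzMicroSectors.NormalFormPrinciple.PiBox
open Summit.KontsevichZagierPeriods.HurwitzMicroSectors.NormalFormPrinciple.PiBox.stub_boxCombineAux
  (pad_le sub_same)

/-! ## V2284 ⇒ `BoxVanishing 5` -/

/-- **V2284 ⇒ `BoxVanishing 5`**: compare a box-rational `N : IntegralRep 5` of value `0` with the zero
representation on the `0`-box (`m' = 0 ≤ 2`; box-rational, value `0`, itself a relation).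
[cite: KontsevichZagier2001, §1.2 Conjecture 1] -/
theorem boxVanishing_five_of_stub_boxRigidity_var2284
    (h : ∀ (m' : ℕ) (N : IntegralRep 5) (N' : IntegralRep m'), m' ≤ 2 → N.domain = {x | ∀ i, x i ∈ Set.Ioo (0:ℝ) 1} → N.IsRational → N'.domain = {x | ∀ i, x i ∈ Set.Ioo (0:ℝ) 1} → N'.IsRational → N.value = N'.value → Equivalent N N')
    (N : IntegralRep 5) (hNd : N.domain = {x | ∀ i, x i ∈ Set.Ioo (0:ℝ) 1}) (hNr : N.IsRational)
    (hv : N.value = 0) : of N ∈ relations := by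
  obtain ⟨Z, hZd, hZi⟩ := exists_zeroRep (isSemialgebraic_box 0)
  have hZ : of Z ∈ relations := of_mem_relations_of_eqOn_zero Z (by simp [hZi, EqOn])
  have hZv : Z.value = 0 := by simp [IntegralRep.value, hZi]
  have hZr : Z.IsRational := ⟨0, 1, fun x _ => by simp, fun x _ => by simp [hZi]⟩
  have h' : of N - of Z ∈ relations := h 0 N Z (Nat.zero_le 2) hNd hNr hZd hZr (by rw [hv, hZv])
  have := relations.add_mem h' hZ
  rwa [sub_add_cancel] at this

/-! ## `BoxVanishing 5` ⇒ `BoxRigidity` for `m, m' ≤ 5`, and ⇒ `BoxVanishing ≤ 5` -/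

/-- **`BoxVanishing 5` ⇒ `BoxRigidity` for `m, m' ≤ 5`**: pad both representations to the `5`-box by
unit intervals (`pad_le`: Newton–Leibniz moves plus null faces), subtract the integrands on the common
box (`sub_same`, rule 1b)); the difference is box-rational of value `0` by soundness, hence a relation.
[cite: KontsevichZagier2001, §1.2 Conjecture 1] -/
theorem boxRigidityLe_five_of_boxVanishing_five
    (hvan : ∀ (M : IntegralRep 5), M.domain = {x | ∀ i, x i ∈ Set.Ioo (0:ℝ) 1} → M.IsRational →
      M.value = 0 → of M ∈ relations) :
    ∀ (m m' : ℕ) (N : IntegralRep m) (N' : IntegralRep m'), m ≤ 5 → m' ≤ 5 →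
      N.domain = {x | ∀ i, x i ∈ Set.Ioo (0:ℝ) 1} → N.IsRational →
      N'.domain = {x | ∀ i, x i ∈ Set.Ioo (0:ℝ) 1} → N'.IsRational →
      N.value = N'.value → Equivalent N N' := by
  intro m m' N N' hm hm' hNd hNr hN'd hN'r hv
  obtain ⟨R₁, h₁d, h₁r, h₁⟩ := pad_le hm N hNd hNr
  obtain ⟨R₂, h₂d, h₂r, h₂⟩ := pad_le hm' N' hN'd hN'r
  obtain ⟨M, hMd, hMr, hM⟩ := sub_same R₁ R₂ h₁d h₁r h₂d h₂r
  have hv₁ : N.value = R₁.value := Equivalent.value_eq_holds h₁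
  have hv₂ : N'.value = R₂.value := Equivalent.value_eq_holds h₂
  have hv₁₂ : R₁.value = R₂.value := by rw [← hv₁, ← hv₂, hv]
  have hMv : M.value = 0 := by
    have e := relations_le_ker_eval_holds hM
    rw [AddMonoidHom.mem_ker, map_sub, map_sub, eval_of, eval_of, eval_of, hv₁₂, sub_self,
      zero_sub, neg_eq_zero] at e
    exact e
  have h₁₂ : of R₁ - of R₂ ∈ relations := by
    have := relations.add_mem hM (hvan M hMd hMr hMv)
    rwa [sub_add_cancel] at this
  have e : of N - of N' = (of N - of R₁) + (of R₁ - of R₂) - (of N' - of R₂) := by abel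
  show of N - of N' ∈ relations
  rw [e]
  exact relations.sub_mem (relations.add_mem h₁ h₁₂) h₂

/-- **`BoxVanishing 5` ⇒ `BoxVanishing j` for every `j ≤ 5`**: pad a vanishing box-rational
representation of dimension `j` to the `5`-box (`pad_le`); the value is unchanged by soundness.
[cite: KontsevichZagier2001, §1.2] -/
theorem boxVanishing_le_five_of_boxVanishing_five
    (hvan : ∀ (M : IntegralRep 5), M.domain = {x | ∀ i, x i ∈ Set.Ioo (0:ℝ) 1} → M.IsRational →
      M.value = 0 → of M ∈ relations)
    {j : ℕ} (hj : j ≤ 5) (N : IntegralRep j) (hNd : N.domain = {x | ∀ i, x i ∈ Set.Ioo (0:ℝ) 1})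
    (hNr : N.IsRational) (hv : N.value = 0) : of N ∈ relations := by
  obtain ⟨R, hRd, hRr, hR⟩ := pad_le hj N hNd hNr
  have hRv : R.value = 0 := by rw [← Equivalent.value_eq_holds hR, hv]
  have := relations.add_mem hR (hvan R hRd hRr hRv)
  rwa [sub_add_cancel] at this

/-! ## The variant V2284 itself: exactly `BoxVanishing 5` -/

/-- **V2284 ⟺ `BoxVanishing 5`** — the exact strength of the variant: Conjecture 1 for box-rational
periods of dimension `≤ 5`. [cite: KontsevichZagier2001, §1.2 Conjecture 1] -/
theorem stub_boxRigidity_var2284_iff_boxVanishing_five :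
    (∀ (m' : ℕ) (N : IntegralRep 5) (N' : IntegralRep m'), m' ≤ 2 → N.domain = {x | ∀ i, x i ∈ Set.Ioo (0:ℝ) 1} → N.IsRational → N'.domain = {x | ∀ i, x i ∈ Set.Ioo (0:ℝ) 1} → N'.IsRational → N.value = N'.value → Equivalent N N') ↔
    (∀ (M : IntegralRep 5), M.domain = {x | ∀ i, x i ∈ Set.Ioo (0:ℝ) 1} → M.IsRational →
      M.value = 0 → of M ∈ relations) :=
  ⟨boxVanishing_five_of_stub_boxRigidity_var2284,
    fun hvan m' N N' hm' =>
      boxRigidityLe_five_of_boxVanishing_five hvan 5 m' N N' le_rfl (hm'.trans (by norm_num))⟩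

/-- **V2284 ⟺ `BoxRigidity` for all `m, m' ≤ 5`** (so V2284 coincides with the two-sided variants
`bound_nat:m≤5; bound_nat:m'≤5` and `fix_nat:m=5; fix_nat:m'=k` / `bound_nat:m'≤k` for every `k ≤ 5`,
and with their mirror images). [cite: KontsevichZagier2001, §1.2 Conjecture 1] -/
theorem stub_boxRigidity_var2284_iff_le_five :
    (∀ (m' : ℕ) (N : IntegralRep 5) (N' : IntegralRep m'), m' ≤ 2 → N.domain = {x | ∀ i, x i ∈ Set.Ioo (0:ℝ) 1} → N.IsRational → N'.domain = {x | ∀ i, x i ∈ Set.Ioo (0:ℝ) 1} → N'.IsRational → N.value = N'.value → Equivalent N N') ↔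
    (∀ (m m' : ℕ) (N : IntegralRep m) (N' : IntegralRep m'), m ≤ 5 → m' ≤ 5 →
      N.domain = {x | ∀ i, x i ∈ Set.Ioo (0:ℝ) 1} → N.IsRational →
      N'.domain = {x | ∀ i, x i ∈ Set.Ioo (0:ℝ) 1} → N'.IsRational →
      N.value = N'.value → Equivalent N N') := by
  rw [stub_boxRigidity_var2284_iff_boxVanishing_five]
  refine ⟨boxRigidityLe_five_of_boxVanishing_five, fun h N hNd hNr hv => ?_⟩
  exact boxVanishing_five_of_stub_boxRigidity_var2284
    (fun m' N N' hm' => h 5 m' N N' le_rfl (hm'.trans (by norm_num))) N hNd hNr hv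

/-- **V2284 ⇒ `BoxVanishing` in every dimension `≤ 5`**, in particular the dimension-`2` statement that
every vanishing `ℚ`-combination of absolutely convergent `∫_{(0,1)²} p/q` is generated by the moves —
the first open dimension. [cite: KontsevichZagier2001, §1.2 Conjecture 1] -/
theorem boxVanishing_le_five_of_stub_boxRigidity_var2284
    (h : ∀ (m' : ℕ) (N : IntegralRep 5) (N' : IntegralRep m'), m' ≤ 2 → N.domain = {x | ∀ i, x i ∈ Set.Ioo (0:ℝ) 1} → N.IsRational → N'.domain = {x | ∀ i, x i ∈ Set.Ioo (0:ℝ) 1} → N'.IsRational → N.value = N'.value → Equivalent N N')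
    {j : ℕ} (hj : j ≤ 5) (N : IntegralRep j) (hNd : N.domain = {x | ∀ i, x i ∈ Set.Ioo (0:ℝ) 1})
    (hNr : N.IsRational) (hv : N.value = 0) : of N ∈ relations :=
  boxVanishing_le_five_of_boxVanishing_five (boxVanishing_five_of_stub_boxRigidity_var2284 h) hj N
    hNd hNr hv

/-- **V2284 ⇒ V2238** (the sibling `fix_nat:m=3; bound_nat:m'≤2`, which is exactly `BoxVanishing 3`):
the two-sided variants are linearly ordered by their largest dimension. The converse is not claimed.
[cite: KontsevichZagier2001, §1.2 Conjecture 1] -/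
theorem stub_boxRigidity_var2238_of_stub_boxRigidity_var2284
    (h : ∀ (m' : ℕ) (N : IntegralRep 5) (N' : IntegralRep m'), m' ≤ 2 → N.domain = {x | ∀ i, x i ∈ Set.Ioo (0:ℝ) 1} → N.IsRational → N'.domain = {x | ∀ i, x i ∈ Set.Ioo (0:ℝ) 1} → N'.IsRational → N.value = N'.value → Equivalent N N') :
    ∀ (m' : ℕ) (N : IntegralRep 3) (N' : IntegralRep m'), m' ≤ 2 → N.domain = {x | ∀ i, x i ∈ Set.Ioo (0:ℝ) 1} → N.IsRational → N'.domain = {x | ∀ i, x i ∈ Set.Ioo (0:ℝ) 1} → N'.IsRational → N.value = N'.value → Equivalent N N' :=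
  fun m' N N' hm' => stub_boxRigidity_var2284_iff_le_five.1 h 3 m' N N' (by norm_num)
    (hm'.trans (by norm_num))

/-- **V2284 ⇒ V2338** (the sibling `bound_nat:m≤2; bound_nat:m'≤2`, which is exactly `BoxVanishing 2`,
the weakest open two-sided variant). The converse is not claimed. [cite: KontsevichZagier2001, §1.2 Conjecture 1] -/
theorem stub_boxRigidity_var2338_of_stub_boxRigidity_var2284
    (h : ∀ (m' : ℕ) (N : IntegralRep 5) (N' : IntegralRep m'), m' ≤ 2 → N.domain = {x | ∀ i, x i ∈ Set.Ioo (0:ℝ) 1} → N.IsRational → N'.domain = {x | ∀ i, x i ∈ Set.Ioo (0:ℝ) 1} → N'.IsRational → N.value = N'.value → Equivalent N N') :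
    ∀ (m m' : ℕ) (N : IntegralRep m) (N' : IntegralRep m'), m ≤ 2 → m' ≤ 2 → N.domain = {x | ∀ i, x i ∈ Set.Ioo (0:ℝ) 1} → N.IsRational → N'.domain = {x | ∀ i, x i ∈ Set.Ioo (0:ℝ) 1} → N'.IsRational → N.value = N'.value → Equivalent N N' :=
  fun m m' N N' hm hm' => stub_boxRigidity_var2284_iff_le_five.1 h m m' N N' (hm.trans (by norm_num))
    (hm'.trans (by norm_num))

/-- **The parent leaf ⇒ V2284** (specialisation `m := 5`; the hypothesis `m' ≤ 2` is dropped).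
[cite: KontsevichZagier2001, §1.2 Conjecture 1] -/
theorem stub_boxRigidity_var2284_of_parent
    (h : ∀ (m m' : ℕ) (N : IntegralRep m) (N' : IntegralRep m'), N.domain = {x | ∀ i, x i ∈ Set.Ioo (0:ℝ) 1} → N.IsRational → N'.domain = {x | ∀ i, x i ∈ Set.Ioo (0:ℝ) 1} → N'.IsRational → N.value = N'.value → Equivalent N N') :
    ∀ (m' : ℕ) (N : IntegralRep 5) (N' : IntegralRep m'), m' ≤ 2 → N.domain = {x | ∀ i, x i ∈ Set.Ioo (0:ℝ) 1} → N.IsRational → N'.domain = {x | ∀ i, x i ∈ Set.Ioo (0:ℝ) 1} → N'.IsRational → N.value = N'.value → Equivalent N N' :=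
  fun m' N N' _ => h 5 m' N N'

/-- **`KontsevichZagierPeriods ⇒ V2284`**: the variant is a special case of Conjecture 1 for the tree's
calculus (`leaves_of_statement`) — so a refutation of the variant would refute the Summit.
[cite: KontsevichZagier2001, §1.2 Conjecture 1] -/
theorem stub_boxRigidity_var2284_of_statement (h : _root_.KontsevichZagierPeriods) :
    ∀ (m' : ℕ) (N : IntegralRep 5) (N' : IntegralRep m'), m' ≤ 2 → N.domain = {x | ∀ i, x i ∈ Set.Ioo (0:ℝ) 1} → N.IsRational → N'.domain = {x | ∀ i, x i ∈ Set.Ioo (0:ℝ) 1} → N'.IsRational → N.value = N'.value → Equivalent N N' :=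
  stub_boxRigidity_var2284_of_parent (leaves_of_statement h).1

end Summit.KontsevichZagierPeriods.KontsevichZagierPeriods.Theorems

end
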